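import Mathlib
import Literature.Computability.Complexity.RandomKSatEnsembleOGP

/-!
# Route OverlapGapAlgebra, crux `SearchHardWindow` (stmt-PneNP-2460): refresh expansion / block
# structure of one slot of the resampling chain

For one clause slot (positions `B`, alphabet `Γ`, times `Fin (L+1)`) of the `ε`-resampling chain of
literal arrays (Huang–Sellke 2025 §3.3.2) the multi-time weight of a version array
`w : Fin (L+1) → B → Γ` is `∏_ℓ P_{δ ℓ}(w ℓ, w (ℓ+1))` with the resampling kernel
`P_δ(y, y') = ∏_b ((1 − δ)·[y b = y' b] + δ/|Γ|)` (`resampleKernel` of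
`Literature/Computability/Complexity/RandomKSatEnsembleOGP.lean`); it is not normalised (the
time-`0` value is free, total weight `#(B → Γ)`).

`stub_blockExpansion`: for `g ≥ 0`, the weighted sum `Σ_w weight(w) · g w` is at most `M · #(B → Γ)`
as soon as for EVERY admissible block-root map `ρ : B → Fin (L+1) → Fin (L+1)` (`ρ b ℓ ≤ ℓ`, and
`ρ b` constant on `[ρ b ℓ, ℓ]`) the plain sum of `g` over the expanded free arrays
`fun ℓ b => u (ρ b ℓ) b`, `u : Fin (L+1) → B → Γ`, is at most `M · #(Fin (L+1) → B → Γ)`.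

Proof: induction on `L`, peeling the LAST step `w = Fin.snoc w' v` (`bex_sum_snoc`,
`bex_weight_snoc`). The last kernel is a mixture: writing each coordinate factor as
`(1 − ε)[y b = v b] + ε/|Γ| = |Γ|⁻¹ Σ_{x : Γ} Σ_{β : Bool} q β · [v b = (β ? y b : x)]` with
`q true = 1 − ε`, `q false = ε` (`bex_coord_mixture`) and distributing (`Fintype.prod_sum` twice),
`P_ε(y, v) = |Γ|^{-|B|} Σ_{v'} Σ_{s : B → Bool} p_s [v = mix_s y v']`, `p_s = ∏_b q (s b)`,
`mix_s y v' b = (s b ? y b : v' b)` (`bex_kernel_pointwise`), whence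
`Σ_v P_ε(y, v) h v = Σ_s p_s · |Γ|^{-|B|} Σ_{v'} h (mix_s y v')` (`bex_kernel_mixture`) and
`Σ_s p_s = 1` (`bex_pattern_sum`). So the weighted sum at length `L + 1` is the `p_s`-average of the
weighted sums at length `L` of the functionals
`g_s w' = |Γ|^{-|B|} Σ_{v'} g (snoc w' (mix_s (w' L) v'))`, and the induction hypothesis (with the
same `M`) applies to each `g_s`: for an admissible `ρ'` on `Fin (L+1)` the map `ρ` extending it by
`ρ b (L+1) = (s b ? ρ' b L : L+1)` is admissible (`bex_extend_admissible`) and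
`expand_ρ (snoc u' v') = snoc (expand_{ρ'} u') (mix_s (expand_{ρ'} u' L) v')` (`bex_extend_expand`),
so `Σ_{u'} g_s (expand_{ρ'} u') = |Γ|^{-|B|} Σ_u g (expand_ρ u) ≤ |Γ|^{-|B|} M #(Fin (L+2) → B → Γ)`
by the hypothesis at length `L + 1`, and finally `Σ_s p_s · M #(B → Γ) = M #(B → Γ)`.
-/

set_option linter.dupNamespace false -- `Summit.PneNP.PneNP.…`: summit = sub-problem

namespace Summit.PneNP.PneNP.Theorems

open Finset
open Literature.Computability.Complexity
open scoped Classical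

section General

variable {X : Type*} [Fintype X]

/-- Reindex a sum over paths of length `n + 1` by (initial path, last point):
`w = Fin.snoc w' v`. -/
theorem bex_sum_snoc (n : ℕ) (Φ : (Fin (n + 1) → X) → ℝ) :
    ∑ w : Fin (n + 1) → X, Φ w = ∑ w' : Fin n → X, ∑ v : X, Φ (Fin.snoc w' v) := by
  rw [← (Fin.snocEquiv fun _ : Fin (n + 1) => X).sum_comp, Fintype.sum_prod_type, Finset.sum_comm]
  rfl

/-- Pushforward of a mixture of point masses: if `K v = Σ_a Σ_s c a s · [v = φ a s]` then
`Σ_v K v · h v = Σ_a Σ_s c a s · h (φ a s)`. -/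
theorem bex_pushforward {V A S : Type*} [Fintype V] [DecidableEq V] [Fintype A] [Fintype S]
    (K : V → ℝ) (c : A → S → ℝ) (φ : A → S → V)
    (hK : ∀ v, K v = ∑ a, ∑ s, c a s * (if v = φ a s then (1 : ℝ) else 0)) (h : V → ℝ) :
    ∑ v, K v * h v = ∑ a, ∑ s, c a s * h (φ a s) := by
  have step : ∀ a s, ∑ v, (c a s * (if v = φ a s then (1 : ℝ) else 0)) * h v =
      c a s * h (φ a s) := by
    intro a s
    rw [Finset.sum_eq_single (φ a s)]
    · simp
    · intro v _ hv
      simp [hv]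
    · intro h'
      exact absurd (Finset.mem_univ _) h'
  calc ∑ v, K v * h v
      = ∑ v, ∑ a, ∑ s, (c a s * (if v = φ a s then (1 : ℝ) else 0)) * h v := by
        refine Finset.sum_congr rfl fun v _ => ?_
        rw [hK v, Finset.sum_mul]
        exact Finset.sum_congr rfl fun a _ => Finset.sum_mul _ _ _
    _ = ∑ a, ∑ v, ∑ s, (c a s * (if v = φ a s then (1 : ℝ) else 0)) * h v := Finset.sum_comm
    _ = ∑ a, ∑ s, ∑ v, (c a s * (if v = φ a s then (1 : ℝ) else 0)) * h v :=
        Finset.sum_congr rfl fun a _ => Finset.sum_comm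
    _ = ∑ a, ∑ s, c a s * h (φ a s) :=
        Finset.sum_congr rfl fun a _ => Finset.sum_congr rfl fun s _ => step a s

/-- Rearrangement `Σ_w a w · Σ_s p s · F s w = Σ_s p s · Σ_w a w · F s w`. -/
theorem bex_rearrange {W S : Type*} [Fintype W] [Fintype S] (a : W → ℝ) (p : S → ℝ)
    (F : S → W → ℝ) :
    ∑ w, a w * ∑ s, p s * F s w = ∑ s, p s * ∑ w, a w * F s w := by
  simp_rw [Finset.mul_sum]
  rw [Finset.sum_comm]
  exact Finset.sum_congr rfl fun s _ => Finset.sum_congr rfl fun w _ => by ring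

end General

section Slot

variable {B Γ : Type*} [Fintype B] [Fintype Γ]

/-- The path weight of `Fin.snoc w' v` factors as the weight of `w'` times the last step. -/
theorem bex_weight_snoc [DecidableEq Γ] {L : ℕ} (δ : Fin (L + 1) → ℝ) (w' : Fin (L + 1) → B → Γ)
    (v : B → Γ) :
    ∏ ℓ : Fin (L + 1), resampleKernel (δ ℓ)
        ((Fin.snoc w' v : Fin (L + 1 + 1) → B → Γ) ℓ.castSucc)
        ((Fin.snoc w' v : Fin (L + 1 + 1) → B → Γ) ℓ.succ) =
      (∏ ℓ : Fin L, resampleKernel (δ ℓ.castSucc) (w' ℓ.castSucc) (w' ℓ.succ)) *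
        resampleKernel (δ (Fin.last L)) (w' (Fin.last L)) v := by
  rw [Fin.prod_univ_castSucc]
  simp only [Fin.snoc_castSucc, Fin.succ_castSucc, Fin.succ_last, Fin.snoc_last]

/-- Number of arrays one step longer: `#(Fin (n+1) → B → Γ) = #(Fin n → B → Γ) · |Γ|^|B|`. -/
theorem bex_card_succ [DecidableEq B] (n : ℕ) :
    (Fintype.card (Fin (n + 1) → B → Γ) : ℝ) =
      Fintype.card (Fin n → B → Γ) * (Fintype.card Γ : ℝ) ^ Fintype.card B := by
  simp only [Fintype.card_fun, Fintype.card_fin, pow_succ, Nat.cast_mul, Nat.cast_pow]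

variable [DecidableEq B] [DecidableEq Γ] [Nonempty Γ]

/-- One coordinate of the resampling kernel as a uniform mixture over (fresh letter, keep bit):
`(1 − ε)[a = c] + ε/|Γ| = |Γ|⁻¹ Σ_x Σ_β q β · [c = (β ? a : x)]`. -/
theorem bex_coord_mixture (ε : ℝ) (a c : Γ) :
    (1 - ε) * (if a = c then (1 : ℝ) else 0) + ε / Fintype.card Γ =
      (Fintype.card Γ : ℝ)⁻¹ * ∑ x : Γ, ∑ β : Bool,
        (if β then 1 - ε else ε) * (if c = (if β then a else x) then (1 : ℝ) else 0) := by
  have hcard : (Fintype.card Γ : ℝ) ≠ 0 := Nat.cast_ne_zero.mpr Fintype.card_ne_zero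
  have hsum : ∑ x : Γ, ∑ β : Bool,
      (if β then 1 - ε else ε) * (if c = (if β then a else x) then (1 : ℝ) else 0) =
      ∑ x : Γ, ((1 - ε) * (if a = c then (1 : ℝ) else 0) + ε * (if c = x then (1 : ℝ) else 0)) := by
    refine Finset.sum_congr rfl fun x _ => ?_
    rw [Fintype.sum_bool]
    simp only [Bool.false_eq_true, if_true, if_false, eq_comm]
  rw [hsum, Finset.sum_add_distrib, Finset.sum_const, Finset.card_univ, nsmul_eq_mul,
    ← Finset.mul_sum, Finset.sum_ite_eq, if_pos (Finset.mem_univ _)]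
  field_simp

/-- The resampling kernel as a mixture of point masses:
`P_ε(y, v) = |Γ|^{-|B|} Σ_{v'} Σ_{s : B → Bool} p_s · [v = mix_s y v']`. -/
theorem bex_kernel_pointwise (ε : ℝ) (y v : B → Γ) :
    resampleKernel ε y v = ((Fintype.card Γ : ℝ) ^ Fintype.card B)⁻¹ *
      ∑ v' : B → Γ, ∑ s : B → Bool, (∏ b, (if s b then 1 - ε else ε)) *
        (if v = (fun b => if s b then y b else v' b) then (1 : ℝ) else 0) := by
  unfold resampleKernel
  rw [Finset.prod_congr rfl fun b _ => bex_coord_mixture ε (y b) (v b), Finset.prod_mul_distrib,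
    Finset.prod_const, Finset.card_univ, inv_pow]
  congr 1
  rw [Fintype.prod_sum]
  refine Finset.sum_congr rfl fun v' _ => ?_
  rw [Fintype.prod_sum]
  refine Finset.sum_congr rfl fun s _ => ?_
  rw [Finset.prod_mul_distrib, Fintype.prod_boole]
  congr 1
  exact if_congr funext_iff.symm rfl rfl

/-- The last step as a mixture: `Σ_v P_ε(y, v) h v = Σ_s p_s · |Γ|^{-|B|} Σ_{v'} h (mix_s y v')`. -/
theorem bex_kernel_mixture (ε : ℝ) (y : B → Γ) (h : (B → Γ) → ℝ) :
    ∑ v : B → Γ, resampleKernel ε y v * h v =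
      ∑ s : B → Bool, (∏ b, (if s b then 1 - ε else ε)) *
        (((Fintype.card Γ : ℝ) ^ Fintype.card B)⁻¹ *
          ∑ v' : B → Γ, h (fun b => if s b then y b else v' b)) := by
  have hK : ∀ v : B → Γ, resampleKernel ε y v = ∑ v' : B → Γ, ∑ s : B → Bool,
      (((Fintype.card Γ : ℝ) ^ Fintype.card B)⁻¹ * ∏ b, (if s b then 1 - ε else ε)) *
        (if v = (fun b => if s b then y b else v' b) then (1 : ℝ) else 0) := by
    intro v
    rw [bex_kernel_pointwise, Finset.mul_sum]
    refine Finset.sum_congr rfl fun v' _ => ?_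
    rw [Finset.mul_sum]
    exact Finset.sum_congr rfl fun s _ => by ring
  rw [bex_pushforward (resampleKernel ε y)
    (fun (_ : B → Γ) (s : B → Bool) =>
      ((Fintype.card Γ : ℝ) ^ Fintype.card B)⁻¹ * ∏ b, (if s b then 1 - ε else ε))
    (fun v' s => fun b => if s b then y b else v' b) hK h, Finset.sum_comm]
  refine Finset.sum_congr rfl fun s _ => ?_
  rw [Finset.mul_sum, Finset.mul_sum]
  exact Finset.sum_congr rfl fun v' _ => by ring

/-- The mixture weights sum to one: `Σ_{s : B → Bool} ∏_b q (s b) = ∏_b ((1 − ε) + ε) = 1`. -/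
theorem bex_pattern_sum (ε : ℝ) : ∑ s : B → Bool, ∏ b, (if s b then 1 - ε else ε) = 1 := by
  rw [← Fintype.prod_sum fun (_ : B) (β : Bool) => if β then 1 - ε else ε]
  simp

end Slot

section Roots

variable {B Γ : Type*} {L : ℕ}

/-- The extension `ρ` of an admissible root map `ρ'` on `Fin (L+1)` by a last step with keep set
`s` (`ρ b (L+1) = ρ' b L` if `s b`, else `L+1`) is admissible. -/
theorem bex_extend_admissible (s : B → Bool) (ρ' : B → Fin (L + 1) → Fin (L + 1))
    (h1 : ∀ b ℓ, ρ' b ℓ ≤ ℓ) (h2 : ∀ b ℓ ℓ', ρ' b ℓ ≤ ℓ' → ℓ' ≤ ℓ → ρ' b ℓ' = ρ' b ℓ)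
    (ρ : B → Fin (L + 1 + 1) → Fin (L + 1 + 1))
    (hc : ∀ b (ℓ : Fin (L + 1)), ρ b ℓ.castSucc = (ρ' b ℓ).castSucc)
    (hl : ∀ b, ρ b (Fin.last (L + 1)) =
      if s b then (ρ' b (Fin.last L)).castSucc else Fin.last (L + 1)) :
    (∀ b ℓ, ρ b ℓ ≤ ℓ) ∧ (∀ b ℓ ℓ', ρ b ℓ ≤ ℓ' → ℓ' ≤ ℓ → ρ b ℓ' = ρ b ℓ) := by
  refine ⟨fun b ℓ => ?_, fun b ℓ ℓ' hℓ' hℓ => ?_⟩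
  · obtain ⟨m, rfl⟩ | rfl := ℓ.eq_castSucc_or_eq_last
    · rw [hc]
      exact Fin.castSucc_le_castSucc_iff.mpr (h1 b m)
    · exact Fin.le_last _
  · obtain ⟨m, rfl⟩ | rfl := ℓ.eq_castSucc_or_eq_last
    · obtain ⟨m', rfl⟩ | rfl := ℓ'.eq_castSucc_or_eq_last
      · rw [hc] at hℓ' ⊢
        rw [hc, h2 b m m' (Fin.castSucc_le_castSucc_iff.mp hℓ')
          (Fin.castSucc_le_castSucc_iff.mp hℓ)]
      · exact absurd hℓ (not_le.mpr (Fin.castSucc_lt_last m))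
    · obtain ⟨m', rfl⟩ | rfl := ℓ'.eq_castSucc_or_eq_last
      · rw [hl] at hℓ' ⊢
        by_cases hb : s b
        · rw [if_pos hb] at hℓ' ⊢
          rw [hc, h2 b (Fin.last L) m' (Fin.castSucc_le_castSucc_iff.mp hℓ') (Fin.le_last _)]
        · rw [if_neg hb] at hℓ'
          exact absurd hℓ' (not_le.mpr (Fin.castSucc_lt_last m'))
      · rfl

/-- Expanding a free array `Fin.snoc u' v'` along the extended root map `ρ` gives the expansion of
`u'` along `ρ'`, followed by the last step "keep on `s`, refresh from `v'` off `s`". -/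
theorem bex_extend_expand (s : B → Bool) (ρ' : B → Fin (L + 1) → Fin (L + 1))
    (ρ : B → Fin (L + 1 + 1) → Fin (L + 1 + 1))
    (hc : ∀ b (ℓ : Fin (L + 1)), ρ b ℓ.castSucc = (ρ' b ℓ).castSucc)
    (hl : ∀ b, ρ b (Fin.last (L + 1)) =
      if s b then (ρ' b (Fin.last L)).castSucc else Fin.last (L + 1))
    (u' : Fin (L + 1) → B → Γ) (v' : B → Γ) :
    (fun ℓ b => (Fin.snoc u' v' : Fin (L + 1 + 1) → B → Γ) (ρ b ℓ) b) =
      Fin.snoc (fun ℓ b => u' (ρ' b ℓ) b)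
        (fun b => if s b then u' (ρ' b (Fin.last L)) b else v' b) := by
  funext ℓ b
  obtain ⟨m, rfl⟩ | rfl := ℓ.eq_castSucc_or_eq_last
  · rw [hc, Fin.snoc_castSucc, Fin.snoc_castSucc]
  · rw [hl, Fin.snoc_last]
    by_cases hb : s b
    · rw [if_pos hb, if_pos hb, Fin.snoc_castSucc]
    · rw [if_neg hb, if_neg hb, Fin.snoc_last]

end Roots

section Main

variable {B Γ : Type} [Fintype B] [DecidableEq B] [Fintype Γ] [DecidableEq Γ]

/-- Base case `L = 0`: the weight is `1` and `ρ b ℓ = ℓ` is admissible. -/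
theorem bex_base (δ : Fin 0 → ℝ) (g : (Fin (0 + 1) → B → Γ) → ℝ) (M : ℝ)
    (hM : ∀ ρ : B → Fin (0 + 1) → Fin (0 + 1), (∀ b ℓ, ρ b ℓ ≤ ℓ) →
      (∀ b ℓ ℓ', ρ b ℓ ≤ ℓ' → ℓ' ≤ ℓ → ρ b ℓ' = ρ b ℓ) →
      ∑ u : Fin (0 + 1) → B → Γ, g (fun ℓ b => u (ρ b ℓ) b) ≤
        M * Fintype.card (Fin (0 + 1) → B → Γ)) :
    ∑ w : Fin (0 + 1) → B → Γ,
        (∏ ℓ : Fin 0, resampleKernel (δ ℓ) (w ℓ.castSucc) (w ℓ.succ)) * g w ≤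
      M * Fintype.card (B → Γ) := by
  have key := hM (fun _ ℓ => ℓ) (fun _ _ => le_rfl) (fun _ _ _ h h' => le_antisymm h' h)
  have hcard : (Fintype.card (Fin (0 + 1) → B → Γ) : ℝ) = Fintype.card (B → Γ) := by
    rw [bex_card_succ 0]
    simp
  rw [hcard] at key
  simpa using key

variable [Nonempty Γ]

/-- Induction step `L → L + 1` (see the module docstring). -/
theorem bex_step {L : ℕ} (M : ℝ)
    (ih : ∀ (δ : Fin L → ℝ), (∀ ℓ, 0 ≤ δ ℓ) → (∀ ℓ, δ ℓ ≤ 1) →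
      ∀ (g : (Fin (L + 1) → B → Γ) → ℝ), (∀ w, 0 ≤ g w) →
      (∀ ρ : B → Fin (L + 1) → Fin (L + 1), (∀ b ℓ, ρ b ℓ ≤ ℓ) →
        (∀ b ℓ ℓ', ρ b ℓ ≤ ℓ' → ℓ' ≤ ℓ → ρ b ℓ' = ρ b ℓ) →
        ∑ u : Fin (L + 1) → B → Γ, g (fun ℓ b => u (ρ b ℓ) b) ≤
          M * Fintype.card (Fin (L + 1) → B → Γ)) →
      ∑ w : Fin (L + 1) → B → Γ,
          (∏ ℓ : Fin L, resampleKernel (δ ℓ) (w ℓ.castSucc) (w ℓ.succ)) * g w ≤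
        M * Fintype.card (B → Γ))
    (δ : Fin (L + 1) → ℝ) (hδ0 : ∀ ℓ, 0 ≤ δ ℓ) (hδ1 : ∀ ℓ, δ ℓ ≤ 1)
    (g : (Fin (L + 1 + 1) → B → Γ) → ℝ) (hg : ∀ w, 0 ≤ g w)
    (hM : ∀ ρ : B → Fin (L + 1 + 1) → Fin (L + 1 + 1), (∀ b ℓ, ρ b ℓ ≤ ℓ) →
      (∀ b ℓ ℓ', ρ b ℓ ≤ ℓ' → ℓ' ≤ ℓ → ρ b ℓ' = ρ b ℓ) →
      ∑ u : Fin (L + 1 + 1) → B → Γ, g (fun ℓ b => u (ρ b ℓ) b) ≤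
        M * Fintype.card (Fin (L + 1 + 1) → B → Γ)) :
    ∑ w : Fin (L + 1 + 1) → B → Γ,
        (∏ ℓ : Fin (L + 1), resampleKernel (δ ℓ) (w ℓ.castSucc) (w ℓ.succ)) * g w ≤
      M * Fintype.card (B → Γ) := by
  set ε : ℝ := δ (Fin.last L) with hε
  set C : ℝ := ((Fintype.card Γ : ℝ) ^ Fintype.card B)⁻¹ with hC
  have hP : (Fintype.card Γ : ℝ) ^ Fintype.card B ≠ 0 :=
    pow_ne_zero _ (Nat.cast_ne_zero.mpr Fintype.card_ne_zero)
  have hC0 : 0 ≤ C := inv_nonneg.mpr (pow_nonneg (Nat.cast_nonneg _) _)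
  -- Step 1: the weighted sum at length `L + 1` as a `p_s`-mixture of weighted sums at length `L`.
  have hLHS : ∑ w : Fin (L + 1 + 1) → B → Γ,
        (∏ ℓ : Fin (L + 1), resampleKernel (δ ℓ) (w ℓ.castSucc) (w ℓ.succ)) * g w =
      ∑ s : B → Bool, (∏ b, (if s b then 1 - ε else ε)) *
        ∑ w' : Fin (L + 1) → B → Γ,
          (∏ ℓ : Fin L, resampleKernel (δ ℓ.castSucc) (w' ℓ.castSucc) (w' ℓ.succ)) *
            (C * ∑ v' : B → Γ,
              g (Fin.snoc w' (fun b => if s b then w' (Fin.last L) b else v' b))) := by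
    rw [bex_sum_snoc, ← bex_rearrange]
    refine Finset.sum_congr rfl fun w' _ => ?_
    simp_rw [bex_weight_snoc δ w', mul_assoc]
    rw [← Finset.mul_sum, bex_kernel_mixture]
  -- Step 2: the induction hypothesis for each keep set `s`.
  have hIH : ∀ s : B → Bool,
      ∑ w' : Fin (L + 1) → B → Γ,
          (∏ ℓ : Fin L, resampleKernel (δ ℓ.castSucc) (w' ℓ.castSucc) (w' ℓ.succ)) *
            (C * ∑ v' : B → Γ,
              g (Fin.snoc w' (fun b => if s b then w' (Fin.last L) b else v' b))) ≤
        M * Fintype.card (B → Γ) := by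
    intro s
    refine ih (fun ℓ => δ ℓ.castSucc) (fun ℓ => hδ0 _) (fun ℓ => hδ1 _)
      (fun w' => C * ∑ v' : B → Γ,
        g (Fin.snoc w' (fun b => if s b then w' (Fin.last L) b else v' b)))
      (fun w' => mul_nonneg hC0 (Finset.sum_nonneg fun v' _ => hg _)) ?_
    intro ρ' hρ'1 hρ'2
    dsimp only
    -- the extended root map
    let ρ : B → Fin (L + 1 + 1) → Fin (L + 1 + 1) := fun b =>
      Fin.snoc (fun ℓ => (ρ' b ℓ).castSucc)
        (if s b then (ρ' b (Fin.last L)).castSucc else Fin.last (L + 1))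
    have hc : ∀ b (ℓ : Fin (L + 1)), ρ b ℓ.castSucc = (ρ' b ℓ).castSucc := fun b ℓ => by
      simp only [ρ, Fin.snoc_castSucc]
    have hl : ∀ b, ρ b (Fin.last (L + 1)) =
        if s b then (ρ' b (Fin.last L)).castSucc else Fin.last (L + 1) := fun b => by
      simp only [ρ, Fin.snoc_last]
    obtain ⟨hρ1, hρ2⟩ := bex_extend_admissible s ρ' hρ'1 hρ'2 ρ hc hl
    have key : ∑ u' : Fin (L + 1) → B → Γ, ∑ v' : B → Γ,
        g (Fin.snoc (fun ℓ b => u' (ρ' b ℓ) b)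
          (fun b => if s b then u' (ρ' b (Fin.last L)) b else v' b)) ≤
        M * Fintype.card (Fin (L + 1 + 1) → B → Γ) := by
      refine le_of_eq_of_le ?_ (hM ρ hρ1 hρ2)
      rw [bex_sum_snoc (L + 1)]
      refine Finset.sum_congr rfl fun u' _ => Finset.sum_congr rfl fun v' _ => congrArg g ?_
      exact (bex_extend_expand s ρ' ρ hc hl u' v').symm
    rw [← Finset.mul_sum]
    refine le_trans (mul_le_mul_of_nonneg_left key hC0) (le_of_eq ?_)
    rw [bex_card_succ (L + 1), hC]
    field_simp
  -- Step 3: average the bounds.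
  have hp0 : ∀ s : B → Bool, 0 ≤ ∏ b, (if s b then 1 - ε else ε) := fun s =>
    Finset.prod_nonneg fun b _ => by
      by_cases hb : s b
      · rw [if_pos hb]; exact sub_nonneg.mpr (hδ1 _)
      · rw [if_neg hb]; exact hδ0 _
  rw [hLHS]
  calc ∑ s : B → Bool, (∏ b, (if s b then 1 - ε else ε)) *
        ∑ w' : Fin (L + 1) → B → Γ,
          (∏ ℓ : Fin L, resampleKernel (δ ℓ.castSucc) (w' ℓ.castSucc) (w' ℓ.succ)) *
            (C * ∑ v' : B → Γ,
              g (Fin.snoc w' (fun b => if s b then w' (Fin.last L) b else v' b)))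
      ≤ ∑ s : B → Bool, (∏ b, (if s b then 1 - ε else ε)) * (M * Fintype.card (B → Γ)) :=
        Finset.sum_le_sum fun s _ => mul_le_mul_of_nonneg_left (hIH s) (hp0 s)
    _ = M * Fintype.card (B → Γ) := by rw [← Finset.sum_mul, bex_pattern_sum, one_mul]

end Main

/-- **Refresh expansion / block structure of one slot** (the `R` step of line `Sketch`,
Huang–Sellke 2025 Lemma 3.22): the multi-time weighted sum of a nonnegative `g` over the version
arrays `w : Fin (L+1) → B → Γ` of one slot, with weight `∏_ℓ P_{δ ℓ}(w ℓ, w (ℓ+1))`, is at most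
`M · #(B → Γ)` as soon as for every ADMISSIBLE block-root map `ρ` (`ρ b ℓ ≤ ℓ`, `ρ b` constant on
`[ρ b ℓ, ℓ]`) the plain sum of `g` over the expanded free arrays `fun ℓ b => u (ρ b ℓ) b` is at most
`M · #(Fin (L+1) → B → Γ)`. -/
theorem stub_blockExpansion {B Γ : Type} [Fintype B] [DecidableEq B] [Fintype Γ] [DecidableEq Γ]
    [Nonempty Γ] (L : ℕ) (δ : Fin L → ℝ) (hδ0 : ∀ ℓ, 0 ≤ δ ℓ) (hδ1 : ∀ ℓ, δ ℓ ≤ 1)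
    (g : (Fin (L + 1) → B → Γ) → ℝ) (hg : ∀ w, 0 ≤ g w) (M : ℝ)
    (hM : ∀ ρ : B → Fin (L + 1) → Fin (L + 1), (∀ b ℓ, ρ b ℓ ≤ ℓ) →
      (∀ b ℓ ℓ', ρ b ℓ ≤ ℓ' → ℓ' ≤ ℓ → ρ b ℓ' = ρ b ℓ) →
      ∑ u : Fin (L + 1) → B → Γ, g (fun ℓ b => u (ρ b ℓ) b) ≤
        M * Fintype.card (Fin (L + 1) → B → Γ)) :
    ∑ w : Fin (L + 1) → B → Γ,
        (∏ ℓ : Fin L, resampleKernel (δ ℓ) (w ℓ.castSucc) (w ℓ.succ)) * g w ≤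
      M * Fintype.card (B → Γ) := by
  induction L with
  | zero => exact bex_base δ g M hM
  | succ L ih => exact bex_step M ih δ hδ0 hδ1 g hg hM

end Summit.PneNP.PneNP.Theorems
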